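import Literature.NumberTheory.Rogawski1990.AdelicWeightedOrbitalEulerG2
import Literature.NumberTheory.Rogawski1990.AdelicStableOrbitalEulerAtSingularClasses
import HarnessLib

/-!
# Class-weighted («κ» ∕ Kottwitz-signed) adelic orbital sums, II: the weighted Euler discharge on the QUASI-SPLIT carrier
# `𝒞_𝐀(γ₀) ⊂ ConjClasses U(Φ₃)(𝐀)` at a split semisimple class
(Rogawski (1990), §4.1 (4.1.2) p. 40, §4.3 p. 44, §5.4 (5.4.3) pp. 72–73; Kottwitz (1986), Prop. 7.1, Cor. 7.3)

Topic `NumberTheory/Rogawski1990`; namespace `Literature.NumberTheory.Rogawski1990`; **THEOREMS ONLY** (no definition, no named fact, no instance, no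
notation, no `sorry`).  Cell `pub/hodgecm-mathlib`, ENGINE T1 (crux H413 = `stmt-HodgeConjecture-24833`), row O7, piece **(SA-st-w) §3**: the weighted twin of
★ K6-δ′∘ε𝔸 `MatchingAdeleG.exists_forall_isEulerOnClasses_ofLocalAdelic_of_mul_sub_eq_zero` on the base-point-free carrier `MatchingAdeleG.classes L H γ₀`
(adelic points of `U(Φ₃)` stably conjugate to `γ₀ ∈ U(H)(L⁺)` everywhere) — same statement and proof as §2 of part I with the (G)-side pair-level theorem
★ `MatchingAdeleG.isEulerOnClasses_of_factor_of_eventuallyKConj`.  The Kottwitz-sign letters instantiate the weights.  HC_CM is proved only modulo the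
printed citations until rung 0 closes; this file consumes none of them.

* **`MatchingAdeleG.exists_isEulerOnClasses_ofLocalAdelic_classWeight_of_eventuallyKConj`**, `…exists_forall_…_classWeight_of_eventuallyKConj`,
  **`MatchingAdeleG.exists_forall_isEulerOnClasses_ofLocalAdelic_classWeight_of_mul_sub_eq_zero`**.

## References
* [Rogawski1990] J. D. Rogawski, *Automorphic Representations of Unitary Groups in Three Variables*, Ann. of Math. Stud. 123 (1990), §4.1 (4.1.1)–(4.1.2)
  pp. 39–40, §4.3 p. 44, §5.4 (5.4.3) pp. 72–73, §14.2 (14.2.1) p. 232, §14.5 Lemma 14.5.2 (b) pp. 238–239.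
* [Kottwitz1986] R. E. Kottwitz, *Stable trace formula: elliptic singular terms*, Math. Ann. 275 (1986), 365–399, Prop. 7.1, Cor. 7.3, §9.
* [Gelbart1975] S. Gelbart, *Automorphic Forms on Adele Groups*, Ann. of Math. Stud. 83 (1975), §10 pp. 154–155.
-/

set_option autoImplicit false

noncomputable section

open MeasureTheory NumberField IsDedekindDomain Topology Function Filter
open scoped Matrix MatrixGroups

namespace Literature.NumberTheory.Rogawski1990

open Literature.NumberTheory.Automorphic Literature.MeasureTheory.Group Literature.LinearAlgebra.Matrix
open Literature.AlgebraicGeometry.ShimuraVarieties (unitaryGroup)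

/-! ## §3 The weighted Euler discharge on the quasi-split carrier `𝒞_𝐀(γ₀) ⊂ ConjClasses U(Φ₃)(𝐀)` -/

section EulerG

variable {L : Type} [Field L] [NumberField L] [IsCMField L] {H : Matrix (Fin 3) (Fin 3) L}
  {γ₀ : (UnitaryGroup.cmDatum L 3 H).Rational}
  {γ : (UnitaryGroup.cmDatum L 3 (Matrix.of fun i j : Fin 3 => if i.val + j.val + 1 = 3 then (1 : L) else 0)).Rational}
  [∀ g : (UnitaryGroup.cmDatum L 3 (Matrix.of fun i j : Fin 3 => if i.val + j.val + 1 = 3 then (1 : L) else 0)).Adelic,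
    MeasurableSpace ((UnitaryGroup.cmDatum L 3 (Matrix.of fun i j : Fin 3 => if i.val + j.val + 1 = 3 then (1 : L) else 0)).Adelic ⧸ Subgroup.centralizer ({g} : Set (UnitaryGroup.cmDatum L 3 (Matrix.of fun i j : Fin 3 => if i.val + j.val + 1 = 3 then (1 : L) else 0)).Adelic))]
  [∀ g : (UnitaryGroup.cmDatum L 3 (Matrix.of fun i j : Fin 3 => if i.val + j.val + 1 = 3 then (1 : L) else 0)).Adelic,
    BorelSpace ((UnitaryGroup.cmDatum L 3 (Matrix.of fun i j : Fin 3 => if i.val + j.val + 1 = 3 then (1 : L) else 0)).Adelic ⧸ Subgroup.centralizer ({g} : Set (UnitaryGroup.cmDatum L 3 (Matrix.of fun i j : Fin 3 => if i.val + j.val + 1 = 3 then (1 : L) else 0)).Adelic))]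
  [∀ (v : HeightOneSpectrum (𝓞 ↥(maximalRealSubfield L))) (x : (UnitaryGroup.cmDatum L 3 (Matrix.of fun i j : Fin 3 => if i.val + j.val + 1 = 3 then (1 : L) else 0)).Local v),
    MeasurableSpace ((UnitaryGroup.cmDatum L 3 (Matrix.of fun i j : Fin 3 => if i.val + j.val + 1 = 3 then (1 : L) else 0)).Local v ⧸ Subgroup.centralizer ({x} : Set ((UnitaryGroup.cmDatum L 3 (Matrix.of fun i j : Fin 3 => if i.val + j.val + 1 = 3 then (1 : L) else 0)).Local v)))]
  [∀ (v : HeightOneSpectrum (𝓞 ↥(maximalRealSubfield L))) (x : (UnitaryGroup.cmDatum L 3 (Matrix.of fun i j : Fin 3 => if i.val + j.val + 1 = 3 then (1 : L) else 0)).Local v),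
    BorelSpace ((UnitaryGroup.cmDatum L 3 (Matrix.of fun i j : Fin 3 => if i.val + j.val + 1 = 3 then (1 : L) else 0)).Local v ⧸ Subgroup.centralizer ({x} : Set ((UnitaryGroup.cmDatum L 3 (Matrix.of fun i j : Fin 3 => if i.val + j.val + 1 = 3 then (1 : L) else 0)).Local v)))]
  [∀ a : UnitaryGroup.arch (↥(maximalRealSubfield L)) L (IsCMField.complexConj L) 3 (Matrix.of fun i j : Fin 3 => if i.val + j.val + 1 = 3 then (1 : L) else 0),
    MeasurableSpace (UnitaryGroup.arch (↥(maximalRealSubfield L)) L (IsCMField.complexConj L) 3 (Matrix.of fun i j : Fin 3 => if i.val + j.val + 1 = 3 then (1 : L) else 0) ⧸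
      Subgroup.centralizer ({a} : Set (UnitaryGroup.arch (↥(maximalRealSubfield L)) L (IsCMField.complexConj L) 3 (Matrix.of fun i j : Fin 3 => if i.val + j.val + 1 = 3 then (1 : L) else 0))))]
  [∀ a : UnitaryGroup.arch (↥(maximalRealSubfield L)) L (IsCMField.complexConj L) 3 (Matrix.of fun i j : Fin 3 => if i.val + j.val + 1 = 3 then (1 : L) else 0),
    BorelSpace (UnitaryGroup.arch (↥(maximalRealSubfield L)) L (IsCMField.complexConj L) 3 (Matrix.of fun i j : Fin 3 => if i.val + j.val + 1 = 3 then (1 : L) else 0) ⧸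
      Subgroup.centralizer ({a} : Set (UnitaryGroup.arch (↥(maximalRealSubfield L)) L (IsCMField.complexConj L) 3 (Matrix.of fun i j : Fin 3 => if i.val + j.val + 1 = 3 then (1 : L) else 0))))]

set_option maxHeartbeats 400000 in
/-- **THE WEIGHTED EULER DISCHARGE on the quasi-split carrier `𝒞_𝐀(γ₀) ⊂ ConjClasses U(Φ₃)(𝐀)` AT THE PAIR-LEVEL CLAUSE** — ★ K6-δ (C)
`MatchingAdeleG.exists_isEulerOnClasses_ofLocalAdelic_of_eventuallyKConj` for the CLASS-WEIGHTED function `x ↦ w[x] · T(x)`, where the class weight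
`w` on `𝒞_𝐀(γ₀)` is EULER: `w(c) = warch[c_∞] · ∏_{v ∈ S_w(c)} wloc_v[c_v]` with `wloc_v[c_v] = 1` off the finite `S_w(c)` (`hwE`), and `wloc_v[γ_v] = 1` for
almost all `v` at the rational base point (`hw1`) — the shape of the Kottwitz sign `e = e_∞ · ∏ᶠ_v e_v` and of the endoscopic weight `κ`.  THEN
`∃ S₁, ∀ S ⊇ S₁, IsEulerOnClasses 𝒞_𝐀(γ₀) (ofLocalAdelic mq mqi) (w[·] · T) S (v ↦ Σ_{x ∼ γ_v} wloc_v[x] Φ_v(x, T_v; mq_v)) (Σ_{a ∼ γ ⊗ 1} warch[a] Φ_∞(a, T_∞; mqi))`,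
i.e. the κ-WEIGHTED adelic sum factors into the κ-weighted local sums.  Same proof as ★ K6-δ (C), every class orbital integral multiplied by its weight (§1).
[cite: Rogawski1990, §4.1 (4.1.2) p. 40; §4.3 p. 44; §5.4 (5.4.3) pp. 72–73] [cite: Kottwitz1986, Prop. 7.1, Cor. 7.3] -/
theorem MatchingAdeleG.exists_isEulerOnClasses_ofLocalAdelic_classWeight_of_eventuallyKConj
    (hγ : Corresponds (cmConjRingHom L) H (Matrix.of fun i j : Fin 3 => if i.val + j.val + 1 = 3 then (1 : L) else 0) γ₀ γ)
    (hKCγ : ∀ᶠ v in cofinite, ∀ g : (UnitaryGroup.cmDatum L 3 (Matrix.of fun i j : Fin 3 => if i.val + j.val + 1 = 3 then (1 : L) else 0)).Local v,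
      g ∈ UnitaryGroup.cmLocalIntegralLevel L 3 (Matrix.of fun i j : Fin 3 => if i.val + j.val + 1 = 3 then (1 : L) else 0) v →
        Corresponds (UnitaryGroup.conjLocal L (IsCMField.complexConj L) v)
            ((UnitaryGroup.adelicForm L 3 H).map (UnitaryGroup.adeleToLocal L v))
            ((UnitaryGroup.adelicForm L 3 (Matrix.of fun i j : Fin 3 => if i.val + j.val + 1 = 3 then (1 : L) else 0)).map (UnitaryGroup.adeleToLocal L v))
            ((UnitaryGroup.cmDatum L 3 H).toLocal v ((UnitaryGroup.cmDatum L 3 H).toAdelic γ₀)) g →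
          ∃ k ∈ UnitaryGroup.cmLocalIntegralLevel L 3 (Matrix.of fun i j : Fin 3 => if i.val + j.val + 1 = 3 then (1 : L) else 0) v,
            k * (UnitaryGroup.cmDatum L 3 (Matrix.of fun i j : Fin 3 => if i.val + j.val + 1 = 3 then (1 : L) else 0)).toLocal v ((UnitaryGroup.cmDatum L 3 (Matrix.of fun i j : Fin 3 => if i.val + j.val + 1 = 3 then (1 : L) else 0)).toAdelic γ) * k⁻¹ = g)
    (mq : ∀ v : HeightOneSpectrum (𝓞 ↥(maximalRealSubfield L)),
      OrbitalMeasureFamily ((UnitaryGroup.cmDatum L 3 (Matrix.of fun i j : Fin 3 => if i.val + j.val + 1 = 3 then (1 : L) else 0)).Local v))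
    (mqi : OrbitalMeasureFamily (UnitaryGroup.arch (↥(maximalRealSubfield L)) L (IsCMField.complexConj L) 3
      (Matrix.of fun i j : Fin 3 => if i.val + j.val + 1 = 3 then (1 : L) else 0)))
    (hadm : ∀ v, (mq v).IsAdmissibleOn fun x : (UnitaryGroup.cmDatum L 3 (Matrix.of fun i j : Fin 3 => if i.val + j.val + 1 = 3 then (1 : L) else 0)).Local v =>
      Corresponds (UnitaryGroup.conjLocal L (IsCMField.complexConj L) v)
        ((UnitaryGroup.adelicForm L 3 H).map (UnitaryGroup.adeleToLocal L v))
        ((UnitaryGroup.adelicForm L 3 (Matrix.of fun i j : Fin 3 => if i.val + j.val + 1 = 3 then (1 : L) else 0)).map (UnitaryGroup.adeleToLocal L v))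
        ((UnitaryGroup.cmDatum L 3 H).toLocal v ((UnitaryGroup.cmDatum L 3 H).toAdelic γ₀)) x)
    (hadmA : mqi.IsAdmissibleOn fun a : UnitaryGroup.arch (↥(maximalRealSubfield L)) L (IsCMField.complexConj L) 3 (Matrix.of fun i j : Fin 3 => if i.val + j.val + 1 = 3 then (1 : L) else 0) =>
      Corresponds (UnitaryGroup.conjMixed (↥(maximalRealSubfield L)) L (IsCMField.complexConj L)) (UnitaryGroup.archFormOf L 3 H)
        (UnitaryGroup.archFormOf L 3 (Matrix.of fun i j : Fin 3 => if i.val + j.val + 1 = 3 then (1 : L) else 0)) (cmRationalToArch L 3 H γ₀) a)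
    (hO : ∀ v : HeightOneSpectrum (𝓞 ↥(maximalRealSubfield L)),
      IsClosed {x : GL (Fin 3) (UnitaryGroup.LocalRing L v) | ∃ g : GL (Fin 3) (UnitaryGroup.LocalRing L v),
        g * (((UnitaryGroup.cmDatum L 3 (Matrix.of fun i j : Fin 3 => if i.val + j.val + 1 = 3 then (1 : L) else 0)).toLocal v ((UnitaryGroup.cmDatum L 3 (Matrix.of fun i j : Fin 3 => if i.val + j.val + 1 = 3 then (1 : L) else 0)).toAdelic γ)).val :
          GL (Fin 3) (UnitaryGroup.LocalRing L v)) * g⁻¹ = x})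
    (hOi : IsClosed {x : GL (Fin 3) (mixedEmbedding.mixedSpace L) | ∃ g : GL (Fin 3) (mixedEmbedding.mixedSpace L),
        g * ((cmRationalToArch L 3 (Matrix.of fun i j : Fin 3 => if i.val + j.val + 1 = 3 then (1 : L) else 0) γ).val : GL (Fin 3) (mixedEmbedding.mixedSpace L)) * g⁻¹ = x})
    (hnormγ : ∃ S₀ : Finset (HeightOneSpectrum (𝓞 ↥(maximalRealSubfield L))),
      UnitaryGroup.IsNormalisedOff L 3 (Matrix.of fun i j : Fin 3 => if i.val + j.val + 1 = 3 then (1 : L) else 0) mq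
        ((UnitaryGroup.cmDatum L 3 (Matrix.of fun i j : Fin 3 => if i.val + j.val + 1 = 3 then (1 : L) else 0)).toAdelic γ) S₀)
    (hnorm : ∀ p : MatchingAdeleG L H γ₀, ∃ S₀ : Finset (HeightOneSpectrum (𝓞 ↥(maximalRealSubfield L))),
      UnitaryGroup.IsNormalisedOff L 3 (Matrix.of fun i j : Fin 3 => if i.val + j.val + 1 = 3 then (1 : L) else 0) mq p.adele S₀)
    (T : UnitaryGroup.PureTensor L 3 (Matrix.of fun i j : Fin 3 => if i.val + j.val + 1 = 3 then (1 : L) else 0)) (hT : T.IsTest)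
    (hFi : ∀ c ∈ MatchingAdeleG.classes L H γ₀, Integrable
      (descConj (Quotient.out c : (UnitaryGroup.cmDatum L 3 (Matrix.of fun i j : Fin 3 => if i.val + j.val + 1 = 3 then (1 : L) else 0)).Adelic)
        (Subgroup.centralizer ({(Quotient.out c : (UnitaryGroup.cmDatum L 3 (Matrix.of fun i j : Fin 3 => if i.val + j.val + 1 = 3 then (1 : L) else 0)).Adelic)} :
          Set (UnitaryGroup.cmDatum L 3 (Matrix.of fun i j : Fin 3 => if i.val + j.val + 1 = 3 then (1 : L) else 0)).Adelic))
        (centralizer_comm _) T.eval)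
      (UnitaryGroup.OrbitalMeasureFamily.ofLocalAdelic L 3 (Matrix.of fun i j : Fin 3 => if i.val + j.val + 1 = 3 then (1 : L) else 0) mq mqi c))
    -- the class weights: adelic, local, archimedean; Euler on the carrier; trivial at almost every local base point
    (w : ConjClasses (UnitaryGroup.cmDatum L 3 (Matrix.of fun i j : Fin 3 => if i.val + j.val + 1 = 3 then (1 : L) else 0)).Adelic → ℂ)
    (wloc : ∀ v : HeightOneSpectrum (𝓞 ↥(maximalRealSubfield L)), ConjClasses ((UnitaryGroup.cmDatum L 3 (Matrix.of fun i j : Fin 3 => if i.val + j.val + 1 = 3 then (1 : L) else 0)).Local v) → ℂ)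
    (warch : ConjClasses (UnitaryGroup.arch (↥(maximalRealSubfield L)) L (IsCMField.complexConj L) 3 (Matrix.of fun i j : Fin 3 => if i.val + j.val + 1 = 3 then (1 : L) else 0)) → ℂ)
    (hwE : ∀ c ∈ MatchingAdeleG.classes L H γ₀, ∃ Sw : Finset (HeightOneSpectrum (𝓞 ↥(maximalRealSubfield L))),
      (∀ v ∉ Sw, wloc v (ConjClasses.mk ((UnitaryGroup.cmDatum L 3 (Matrix.of fun i j : Fin 3 => if i.val + j.val + 1 = 3 then (1 : L) else 0)).toLocal v (Quotient.out c))) = 1) ∧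
      w c = warch (ConjClasses.mk (UnitaryGroup.archPart (↥(maximalRealSubfield L)) L (IsCMField.complexConj L) 3 (Matrix.of fun i j : Fin 3 => if i.val + j.val + 1 = 3 then (1 : L) else 0) (Quotient.out c))) *
        ∏ v ∈ Sw, wloc v (ConjClasses.mk ((UnitaryGroup.cmDatum L 3 (Matrix.of fun i j : Fin 3 => if i.val + j.val + 1 = 3 then (1 : L) else 0)).toLocal v (Quotient.out c))))
    (hw1 : ∀ᶠ v in cofinite, wloc v (ConjClasses.mk ((UnitaryGroup.cmDatum L 3 (Matrix.of fun i j : Fin 3 => if i.val + j.val + 1 = 3 then (1 : L) else 0)).toLocal v ((UnitaryGroup.cmDatum L 3 (Matrix.of fun i j : Fin 3 => if i.val + j.val + 1 = 3 then (1 : L) else 0)).toAdelic γ))) = 1) :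
    ∃ S₁ : Finset (HeightOneSpectrum (𝓞 ↥(maximalRealSubfield L))), ∀ S : Finset (HeightOneSpectrum (𝓞 ↥(maximalRealSubfield L))), S₁ ⊆ S →
      IsEulerOnClasses (MatchingAdeleG.classes L H γ₀)
        (UnitaryGroup.OrbitalMeasureFamily.ofLocalAdelic L 3 (Matrix.of fun i j : Fin 3 => if i.val + j.val + 1 = 3 then (1 : L) else 0) mq mqi) (fun x => w (ConjClasses.mk x) * T.eval x) S
        (fun v => localStableOrbitalIntegral L 3 (Matrix.of fun i j : Fin 3 => if i.val + j.val + 1 = 3 then (1 : L) else 0) v (mq v) (fun y => wloc v (ConjClasses.mk y) * T.loc v y)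
          ((UnitaryGroup.cmDatum L 3 (Matrix.of fun i j : Fin 3 => if i.val + j.val + 1 = 3 then (1 : L) else 0)).toLocal v
            ((UnitaryGroup.cmDatum L 3 (Matrix.of fun i j : Fin 3 => if i.val + j.val + 1 = 3 then (1 : L) else 0)).toAdelic γ)))
        (archStableOrbitalIntegral L 3 (Matrix.of fun i j : Fin 3 => if i.val + j.val + 1 = 3 then (1 : L) else 0) mqi (fun a => warch (ConjClasses.mk a) * T.arch a)
          (cmRationalToArch L 3 (Matrix.of fun i j : Fin 3 => if i.val + j.val + 1 = 3 then (1 : L) else 0) γ)) := by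
  classical
  -- admissibility triples at a local point corresponding to `(γ₀)_v` (class-local hypothesis `hadm`, read at `out [x]`)
  have hadmAt : ∀ v (x : (UnitaryGroup.cmDatum L 3 (Matrix.of fun i j : Fin 3 => if i.val + j.val + 1 = 3 then (1 : L) else 0)).Local v),
      Corresponds (UnitaryGroup.conjLocal L (IsCMField.complexConj L) v)
        ((UnitaryGroup.adelicForm L 3 H).map (UnitaryGroup.adeleToLocal L v))
        ((UnitaryGroup.adelicForm L 3 (Matrix.of fun i j : Fin 3 => if i.val + j.val + 1 = 3 then (1 : L) else 0)).map (UnitaryGroup.adeleToLocal L v))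
        ((UnitaryGroup.cmDatum L 3 H).toLocal v ((UnitaryGroup.cmDatum L 3 H).toAdelic γ₀)) x →
      mq v (ConjClasses.mk x) ≠ 0 ∧ SMulInvariantMeasure _ _ (mq v (ConjClasses.mk x)) ∧ IsFiniteMeasureOnCompacts (mq v (ConjClasses.mk x)) :=
    fun v x hx => hadm v (ConjClasses.mk x) (hx.of_isStablyConj_right (isStablyConj_of_isConj (isConj_out_conjClasses_mk x)))
  -- (1) the (KC) places of the pair `(γ₀, γ)`
  have hKfin := Filter.eventually_cofinite.1 hKCγ
  -- (2) the unit-factor places at the base class `[γ_v]` (★ K6-β at `(Matrix.of fun i j : Fin 3 => if i.val + j.val + 1 = 3 then (1 : L) else 0)`)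
  obtain ⟨S₀γ, hS₀γ⟩ := hnormγ
  have hunit := UnitaryGroup.eventually_classOrbitalIntegral_indicator_eq_one_of_integralConj L 3 (Matrix.of fun i j : Fin 3 => if i.val + j.val + 1 = 3 then (1 : L) else 0) mq γ
    (MatchingAdeleG.isConj_toLocal_of_eventuallyKConj hγ hKCγ)
    (fun v => (hadmAt v _ (corresponds_toLocal_toAdelic hγ v)).2.1) hS₀γ
  have hUfin := Filter.eventually_cofinite.1 hunit
  -- (3) the places where the weight is trivial at the base class
  have hWfin := Filter.eventually_cofinite.1 hw1
  refine ⟨T.S ∪ hKfin.toFinset ∪ hUfin.toFinset ∪ hWfin.toFinset, fun S hS => ?_⟩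
  have hS_T : ∀ v ∉ S, v ∉ T.S := fun v hv h =>
    hv (hS (Finset.mem_union_left _ (Finset.mem_union_left _ (Finset.mem_union_left _ h))))
  have hS_K : ∀ v ∉ S, ∀ g : (UnitaryGroup.cmDatum L 3 (Matrix.of fun i j : Fin 3 => if i.val + j.val + 1 = 3 then (1 : L) else 0)).Local v,
      g ∈ UnitaryGroup.cmLocalIntegralLevel L 3 (Matrix.of fun i j : Fin 3 => if i.val + j.val + 1 = 3 then (1 : L) else 0) v →
      Corresponds (UnitaryGroup.conjLocal L (IsCMField.complexConj L) v)
          ((UnitaryGroup.adelicForm L 3 H).map (UnitaryGroup.adeleToLocal L v))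
          ((UnitaryGroup.adelicForm L 3 (Matrix.of fun i j : Fin 3 => if i.val + j.val + 1 = 3 then (1 : L) else 0)).map (UnitaryGroup.adeleToLocal L v))
          ((UnitaryGroup.cmDatum L 3 H).toLocal v ((UnitaryGroup.cmDatum L 3 H).toAdelic γ₀)) g →
        ∃ k ∈ UnitaryGroup.cmLocalIntegralLevel L 3 (Matrix.of fun i j : Fin 3 => if i.val + j.val + 1 = 3 then (1 : L) else 0) v,
          k * (UnitaryGroup.cmDatum L 3 (Matrix.of fun i j : Fin 3 => if i.val + j.val + 1 = 3 then (1 : L) else 0)).toLocal v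
                ((UnitaryGroup.cmDatum L 3 (Matrix.of fun i j : Fin 3 => if i.val + j.val + 1 = 3 then (1 : L) else 0)).toAdelic γ) * k⁻¹ = g := by
    intro v hv
    by_contra hnot
    exact hv (hS (Finset.mem_union_left _ (Finset.mem_union_left _ (Finset.mem_union_right _ (hKfin.mem_toFinset.2 hnot)))))
  have hS_U : ∀ v ∉ S, classOrbitalIntegral (mq v)
      ((UnitaryGroup.cmLocalIntegralLevel L 3 (Matrix.of fun i j : Fin 3 => if i.val + j.val + 1 = 3 then (1 : L) else 0) v :
        Set ((UnitaryGroup.cmDatum L 3 (Matrix.of fun i j : Fin 3 => if i.val + j.val + 1 = 3 then (1 : L) else 0)).Local v)).indicator fun _ => (1 : ℂ))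
      (ConjClasses.mk ((UnitaryGroup.cmDatum L 3 (Matrix.of fun i j : Fin 3 => if i.val + j.val + 1 = 3 then (1 : L) else 0)).toLocal v
        ((UnitaryGroup.cmDatum L 3 (Matrix.of fun i j : Fin 3 => if i.val + j.val + 1 = 3 then (1 : L) else 0)).toAdelic γ))) = 1 := by
    intro v hv
    by_contra hnot
    exact hv (hS (Finset.mem_union_left _ (Finset.mem_union_right _ (hUfin.mem_toFinset.2 hnot))))
  have hS_W : ∀ v ∉ S, wloc v (ConjClasses.mk ((UnitaryGroup.cmDatum L 3 (Matrix.of fun i j : Fin 3 => if i.val + j.val + 1 = 3 then (1 : L) else 0)).toLocal v ((UnitaryGroup.cmDatum L 3 (Matrix.of fun i j : Fin 3 => if i.val + j.val + 1 = 3 then (1 : L) else 0)).toAdelic γ))) = 1 := by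
    intro v hv
    by_contra hnot
    exact hv (hS (Finset.mem_union_right _ (hWfin.mem_toFinset.2 hnot)))
  refine MatchingAdeleG.isEulerOnClasses_of_factor_of_eventuallyKConj hγ hKCγ _ (fun x => w (ConjClasses.mk x) * T.eval x) mq
    (fun v y => wloc v (ConjClasses.mk y) * T.loc v y) mqi (fun a => warch (ConjClasses.mk a) * T.arch a) S
    (fun c hc => ?_) (fun v hv => ?_) (fun v hv d hd hne => ?_) (fun v _ => ?_) ?_
  · -- (fac) ★ C3 at the class `c`, unit factors off `S ∪ {v | local class of c ≠ [γ_v]} ∪ S_w(c)`, then the weights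
    obtain ⟨p, rfl⟩ := hc
    obtain ⟨Sw, hSw, hwc⟩ := hwE _ (MatchingAdeleG.mk_adele_mem_classes p)
    -- `out [p] ` is the adèle of a matching adèle
    let q : MatchingAdeleG L H γ₀ := p.conj (Quotient.out (ConjClasses.mk p.adele)) (isConj_out_conjClasses_mk p.adele)
    have hq : q.adele = Quotient.out (ConjClasses.mk p.adele) := rfl
    obtain ⟨S₀, hS₀⟩ := hnorm q
    have hev := MatchingAdeleG.eventually_map_toLocal_eq_mk_of_eventuallyKConj hKCγ (MatchingAdeleG.mk_adele_mem_classes p)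
    have hevfin := Filter.eventually_cofinite.1 hev
    -- the unweighted unit factor off `S ∪ S_ev(c)`
    have hunit1 : ∀ v ∉ S ∪ hevfin.toFinset, classOrbitalIntegral (mq v) (T.loc v)
        (ConjClasses.mk ((UnitaryGroup.cmDatum L 3 (Matrix.of fun i j : Fin 3 => if i.val + j.val + 1 = 3 then (1 : L) else 0)).toLocal v (Quotient.out (ConjClasses.mk p.adele)))) = 1 := by
      intro v hv
      have hvS : v ∉ S := fun h => hv (Finset.mem_union_left _ h)
      have hvE : ConjClasses.map ((UnitaryGroup.cmDatum L 3
          (Matrix.of fun i j : Fin 3 => if i.val + j.val + 1 = 3 then (1 : L) else 0)).toLocal v) (ConjClasses.mk p.adele) =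
          ConjClasses.mk ((UnitaryGroup.cmDatum L 3 (Matrix.of fun i j : Fin 3 => if i.val + j.val + 1 = 3 then (1 : L) else 0)).toLocal v
            ((UnitaryGroup.cmDatum L 3 (Matrix.of fun i j : Fin 3 => if i.val + j.val + 1 = 3 then (1 : L) else 0)).toAdelic γ)) := by
        by_contra hnot
        exact hv (Finset.mem_union_right _ (hevfin.mem_toFinset.2 hnot))
      rw [← conjClasses_map_eq_mk_out ((UnitaryGroup.cmDatum L 3
          (Matrix.of fun i j : Fin 3 => if i.val + j.val + 1 = 3 then (1 : L) else 0)).toLocal v) (ConjClasses.mk p.adele),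
        hvE, (hT.isUnramified).loc_eq (hS_T v hvS)]
      exact hS_U v hvS
    refine ⟨S ∪ hevfin.toFinset ∪ Sw, fun v hv => ?_, ?_⟩
    · -- weighted unit factor off `S ∪ S_ev(c) ∪ S_w(c)`
      rw [classOrbitalIntegral_classWeight_mul, hSw v (fun h => hv (Finset.mem_union_right _ h)), one_mul]
      exact hunit1 v (fun h => hv (Finset.mem_union_left _ h))
    · -- the product formula for `T`, times the Euler form of the weight
      have hfacT := UnitaryGroup.classOrbitalIntegral_ofLocalAdelic_eval_eq_mul_prod L 3 _ mq mqi (ConjClasses.mk p.adele) (by rw [hq] at hS₀; exact hS₀)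
        (fun v => hadmAt v _ (by rw [← hq]; exact q.corresponds_toLocal v))
        (hadmA _ (Corresponds.of_isStablyConj_right (by rw [← hq]; exact q.corresponds_arch)
          ((UnitaryGroup.arch (↥(maximalRealSubfield L)) L (IsCMField.complexConj L) 3
            (Matrix.of fun i j : Fin 3 => if i.val + j.val + 1 = 3 then (1 : L) else 0)).subtype.map_isConj (isConj_out_conjClasses_mk _))))
        T (S ∪ hevfin.toFinset ∪ Sw) hT.isUnramified (hFi _ (MatchingAdeleG.mk_adele_mem_classes p))
        (fun v hv => hunit1 v (fun h => hv (Finset.mem_union_left _ h)))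
      -- the weight over the larger finite set
      have hwprod : w (ConjClasses.mk p.adele) =
          warch (ConjClasses.mk (UnitaryGroup.archPart (↥(maximalRealSubfield L)) L (IsCMField.complexConj L) 3 (Matrix.of fun i j : Fin 3 => if i.val + j.val + 1 = 3 then (1 : L) else 0)
            (Quotient.out (ConjClasses.mk p.adele)))) *
          ∏ v ∈ S ∪ hevfin.toFinset ∪ Sw, wloc v (ConjClasses.mk ((UnitaryGroup.cmDatum L 3 (Matrix.of fun i j : Fin 3 => if i.val + j.val + 1 = 3 then (1 : L) else 0)).toLocal v (Quotient.out (ConjClasses.mk p.adele)))) := by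
        rw [hwc]
        exact congrArg _ (Finset.prod_subset Finset.subset_union_right fun v _ hv => hSw v hv)
      rw [classOrbitalIntegral_classWeight_mul, hfacT, hwprod, classOrbitalIntegral_classWeight_mul, mul_mul_mul_comm, ← Finset.prod_mul_distrib]
      refine congrArg _ (Finset.prod_congr rfl fun v _ => ?_)
      rw [classOrbitalIntegral_classWeight_mul]
  · -- (h1) the base class has unit factor off `S`
    rw [classOrbitalIntegral_classWeight_mul, hS_W v hv, one_mul, (hT.isUnramified).loc_eq (hS_T v hv)]
    exact hS_U v hv
  · -- (h0) off `S` the other classes of the local stable class have factor `0`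
    rw [classOrbitalIntegral_classWeight_mul, (hT.isUnramified).loc_eq (hS_T v hv),
      classOrbitalIntegral_indicator_eq_zero_of_corresponds_of_ne v (hS_K v hv) (mq v) d hd hne, mul_zero]
  · -- (hfin)
    exact (finite_support_classOrbitalIntegral_inter_corresponds_local_of_isClosed hγ v (hO v) (mq v)
      (UnitaryGroup.PureTensor.hasCompactSupport_loc hT.isUnramified hT.isFinSmooth v)).subset
      (Set.inter_subset_inter_left _ (support_classOrbitalIntegral_classWeight_mul_subset _ _ _))
  · -- (hfinₐ)
    exact (finite_support_classOrbitalIntegral_inter_corresponds_arch_of_isClosed hγ hOi mqi hT.isArchTest.hasCompactSupport_arch).subset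
      (Set.inter_subset_inter_left _ (support_classOrbitalIntegral_classWeight_mul_subset _ _ _))


/-- **The weighted Euler discharge on the quasi-split carrier `𝒞_𝐀(γ₀) ⊂ ConjClasses U(Φ₃)(𝐀)`, `hFi` DISCHARGED** (★ K6-ε𝔸 FILE 2 `MatchingAdeleG.integrable_descConj_ofLocalAdelic_of_mem_classes_of_eventuallyKConj`).
[cite: Rogawski1990, §4.1 (4.1.2) p. 40; §4.3 p. 44; §5.4 (5.4.3) pp. 72–73] [cite: Kottwitz1986, Prop. 7.1, Cor. 7.3] -/
theorem MatchingAdeleG.exists_forall_isEulerOnClasses_ofLocalAdelic_classWeight_of_eventuallyKConj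
    (hγ : Corresponds (cmConjRingHom L) H (Matrix.of fun i j : Fin 3 => if i.val + j.val + 1 = 3 then (1 : L) else 0) γ₀ γ)
    (hKCγ : ∀ᶠ v in cofinite, ∀ g : (UnitaryGroup.cmDatum L 3 (Matrix.of fun i j : Fin 3 => if i.val + j.val + 1 = 3 then (1 : L) else 0)).Local v,
      g ∈ UnitaryGroup.cmLocalIntegralLevel L 3 (Matrix.of fun i j : Fin 3 => if i.val + j.val + 1 = 3 then (1 : L) else 0) v →
        Corresponds (UnitaryGroup.conjLocal L (IsCMField.complexConj L) v)
            ((UnitaryGroup.adelicForm L 3 H).map (UnitaryGroup.adeleToLocal L v))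
            ((UnitaryGroup.adelicForm L 3 (Matrix.of fun i j : Fin 3 => if i.val + j.val + 1 = 3 then (1 : L) else 0)).map (UnitaryGroup.adeleToLocal L v))
            ((UnitaryGroup.cmDatum L 3 H).toLocal v ((UnitaryGroup.cmDatum L 3 H).toAdelic γ₀)) g →
          ∃ k ∈ UnitaryGroup.cmLocalIntegralLevel L 3 (Matrix.of fun i j : Fin 3 => if i.val + j.val + 1 = 3 then (1 : L) else 0) v,
            k * (UnitaryGroup.cmDatum L 3 (Matrix.of fun i j : Fin 3 => if i.val + j.val + 1 = 3 then (1 : L) else 0)).toLocal v ((UnitaryGroup.cmDatum L 3 (Matrix.of fun i j : Fin 3 => if i.val + j.val + 1 = 3 then (1 : L) else 0)).toAdelic γ) * k⁻¹ = g)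
    (mq : ∀ v : HeightOneSpectrum (𝓞 ↥(maximalRealSubfield L)),
      OrbitalMeasureFamily ((UnitaryGroup.cmDatum L 3 (Matrix.of fun i j : Fin 3 => if i.val + j.val + 1 = 3 then (1 : L) else 0)).Local v))
    (mqi : OrbitalMeasureFamily (UnitaryGroup.arch (↥(maximalRealSubfield L)) L (IsCMField.complexConj L) 3
      (Matrix.of fun i j : Fin 3 => if i.val + j.val + 1 = 3 then (1 : L) else 0)))
    (hadm : ∀ v, (mq v).IsAdmissibleOn fun x : (UnitaryGroup.cmDatum L 3 (Matrix.of fun i j : Fin 3 => if i.val + j.val + 1 = 3 then (1 : L) else 0)).Local v =>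
      Corresponds (UnitaryGroup.conjLocal L (IsCMField.complexConj L) v)
        ((UnitaryGroup.adelicForm L 3 H).map (UnitaryGroup.adeleToLocal L v))
        ((UnitaryGroup.adelicForm L 3 (Matrix.of fun i j : Fin 3 => if i.val + j.val + 1 = 3 then (1 : L) else 0)).map (UnitaryGroup.adeleToLocal L v))
        ((UnitaryGroup.cmDatum L 3 H).toLocal v ((UnitaryGroup.cmDatum L 3 H).toAdelic γ₀)) x)
    (hadmA : mqi.IsAdmissibleOn fun a : UnitaryGroup.arch (↥(maximalRealSubfield L)) L (IsCMField.complexConj L) 3 (Matrix.of fun i j : Fin 3 => if i.val + j.val + 1 = 3 then (1 : L) else 0) =>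
      Corresponds (UnitaryGroup.conjMixed (↥(maximalRealSubfield L)) L (IsCMField.complexConj L)) (UnitaryGroup.archFormOf L 3 H)
        (UnitaryGroup.archFormOf L 3 (Matrix.of fun i j : Fin 3 => if i.val + j.val + 1 = 3 then (1 : L) else 0)) (cmRationalToArch L 3 H γ₀) a)
    (hO : ∀ v : HeightOneSpectrum (𝓞 ↥(maximalRealSubfield L)),
      IsClosed {x : GL (Fin 3) (UnitaryGroup.LocalRing L v) | ∃ g : GL (Fin 3) (UnitaryGroup.LocalRing L v),
        g * (((UnitaryGroup.cmDatum L 3 (Matrix.of fun i j : Fin 3 => if i.val + j.val + 1 = 3 then (1 : L) else 0)).toLocal v ((UnitaryGroup.cmDatum L 3 (Matrix.of fun i j : Fin 3 => if i.val + j.val + 1 = 3 then (1 : L) else 0)).toAdelic γ)).val :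
          GL (Fin 3) (UnitaryGroup.LocalRing L v)) * g⁻¹ = x})
    (hOi : IsClosed {x : GL (Fin 3) (mixedEmbedding.mixedSpace L) | ∃ g : GL (Fin 3) (mixedEmbedding.mixedSpace L),
        g * ((cmRationalToArch L 3 (Matrix.of fun i j : Fin 3 => if i.val + j.val + 1 = 3 then (1 : L) else 0) γ).val : GL (Fin 3) (mixedEmbedding.mixedSpace L)) * g⁻¹ = x})
    (hnormγ : ∃ S₀ : Finset (HeightOneSpectrum (𝓞 ↥(maximalRealSubfield L))),
      UnitaryGroup.IsNormalisedOff L 3 (Matrix.of fun i j : Fin 3 => if i.val + j.val + 1 = 3 then (1 : L) else 0) mq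
        ((UnitaryGroup.cmDatum L 3 (Matrix.of fun i j : Fin 3 => if i.val + j.val + 1 = 3 then (1 : L) else 0)).toAdelic γ) S₀)
    (hnorm : ∀ p : MatchingAdeleG L H γ₀, ∃ S₀ : Finset (HeightOneSpectrum (𝓞 ↥(maximalRealSubfield L))),
      UnitaryGroup.IsNormalisedOff L 3 (Matrix.of fun i j : Fin 3 => if i.val + j.val + 1 = 3 then (1 : L) else 0) mq p.adele S₀)
    (T : UnitaryGroup.PureTensor L 3 (Matrix.of fun i j : Fin 3 => if i.val + j.val + 1 = 3 then (1 : L) else 0)) (hT : T.IsTest)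
    (w : ConjClasses (UnitaryGroup.cmDatum L 3 (Matrix.of fun i j : Fin 3 => if i.val + j.val + 1 = 3 then (1 : L) else 0)).Adelic → ℂ)
    (wloc : ∀ v : HeightOneSpectrum (𝓞 ↥(maximalRealSubfield L)), ConjClasses ((UnitaryGroup.cmDatum L 3 (Matrix.of fun i j : Fin 3 => if i.val + j.val + 1 = 3 then (1 : L) else 0)).Local v) → ℂ)
    (warch : ConjClasses (UnitaryGroup.arch (↥(maximalRealSubfield L)) L (IsCMField.complexConj L) 3 (Matrix.of fun i j : Fin 3 => if i.val + j.val + 1 = 3 then (1 : L) else 0)) → ℂ)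
    (hwE : ∀ c ∈ MatchingAdeleG.classes L H γ₀, ∃ Sw : Finset (HeightOneSpectrum (𝓞 ↥(maximalRealSubfield L))),
      (∀ v ∉ Sw, wloc v (ConjClasses.mk ((UnitaryGroup.cmDatum L 3 (Matrix.of fun i j : Fin 3 => if i.val + j.val + 1 = 3 then (1 : L) else 0)).toLocal v (Quotient.out c))) = 1) ∧
      w c = warch (ConjClasses.mk (UnitaryGroup.archPart (↥(maximalRealSubfield L)) L (IsCMField.complexConj L) 3 (Matrix.of fun i j : Fin 3 => if i.val + j.val + 1 = 3 then (1 : L) else 0) (Quotient.out c))) *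
        ∏ v ∈ Sw, wloc v (ConjClasses.mk ((UnitaryGroup.cmDatum L 3 (Matrix.of fun i j : Fin 3 => if i.val + j.val + 1 = 3 then (1 : L) else 0)).toLocal v (Quotient.out c))))
    (hw1 : ∀ᶠ v in cofinite, wloc v (ConjClasses.mk ((UnitaryGroup.cmDatum L 3 (Matrix.of fun i j : Fin 3 => if i.val + j.val + 1 = 3 then (1 : L) else 0)).toLocal v ((UnitaryGroup.cmDatum L 3 (Matrix.of fun i j : Fin 3 => if i.val + j.val + 1 = 3 then (1 : L) else 0)).toAdelic γ))) = 1) :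
    ∃ S₁ : Finset (HeightOneSpectrum (𝓞 ↥(maximalRealSubfield L))), ∀ S : Finset (HeightOneSpectrum (𝓞 ↥(maximalRealSubfield L))), S₁ ⊆ S →
      IsEulerOnClasses (MatchingAdeleG.classes L H γ₀)
        (UnitaryGroup.OrbitalMeasureFamily.ofLocalAdelic L 3 (Matrix.of fun i j : Fin 3 => if i.val + j.val + 1 = 3 then (1 : L) else 0) mq mqi) (fun x => w (ConjClasses.mk x) * T.eval x) S
        (fun v => localStableOrbitalIntegral L 3 (Matrix.of fun i j : Fin 3 => if i.val + j.val + 1 = 3 then (1 : L) else 0) v (mq v) (fun y => wloc v (ConjClasses.mk y) * T.loc v y)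
          ((UnitaryGroup.cmDatum L 3 (Matrix.of fun i j : Fin 3 => if i.val + j.val + 1 = 3 then (1 : L) else 0)).toLocal v
            ((UnitaryGroup.cmDatum L 3 (Matrix.of fun i j : Fin 3 => if i.val + j.val + 1 = 3 then (1 : L) else 0)).toAdelic γ)))
        (archStableOrbitalIntegral L 3 (Matrix.of fun i j : Fin 3 => if i.val + j.val + 1 = 3 then (1 : L) else 0) mqi (fun a => warch (ConjClasses.mk a) * T.arch a)
          (cmRationalToArch L 3 (Matrix.of fun i j : Fin 3 => if i.val + j.val + 1 = 3 then (1 : L) else 0) γ)) :=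
  MatchingAdeleG.exists_isEulerOnClasses_ofLocalAdelic_classWeight_of_eventuallyKConj hγ hKCγ mq mqi hadm hadmA hO hOi hnormγ hnorm T hT
    (fun c hc => MatchingAdeleG.integrable_descConj_ofLocalAdelic_of_mem_classes_of_eventuallyKConj hγ hKCγ hO hOi mq mqi hadm hadmA hnorm T hT c hc)
    w wloc warch hwE hw1

/-- **THE WEIGHTED (xii-d)-EULER PROPERTY OF THE QUASI-SPLIT CARRIER AT A SPLIT SEMISIMPLE CLASS, kit-side binders only** — `γ₀ ∈ U(H)(L⁺)` with `(γ₀ − a)(γ₀ − b) = 0`, `a ≠ b`,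
a rational correspondent `γ ∈ U((Matrix.of fun i j : Fin 3 => if i.val + j.val + 1 = 3 then (1 : L) else 0))(L⁺)`; the clause, the closed orbits and the integrability are THEOREMS exactly as in ★ K6-δ′∘ε𝔸
`MatchingAdeleG.exists_forall_isEulerOnClasses_ofLocalAdelic_of_mul_sub_eq_zero`. [cite: Rogawski1990, §3.8 Prop. 3.8.1 p. 27; §4.1 (4.1.2) p. 40; §4.3 p. 44;
§5.4 (5.4.3) pp. 72–73] [cite: Kottwitz1986, Prop. 7.1, Cor. 7.3] -/
theorem MatchingAdeleG.exists_forall_isEulerOnClasses_ofLocalAdelic_classWeight_of_mul_sub_eq_zero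
    (hγ : Corresponds (cmConjRingHom L) H (Matrix.of fun i j : Fin 3 => if i.val + j.val + 1 = 3 then (1 : L) else 0) γ₀ γ)
    {a b : L} (hab : a ≠ b)
    (hγab : ((((γ₀ : unitaryGroup (cmConjRingHom L) H).val : GL (Fin 3) L).val : Matrix (Fin 3) (Fin 3) L) - a • (1 : Matrix (Fin 3) (Fin 3) L)) *
      ((((γ₀ : unitaryGroup (cmConjRingHom L) H).val : GL (Fin 3) L).val : Matrix (Fin 3) (Fin 3) L) - b • (1 : Matrix (Fin 3) (Fin 3) L)) = 0)
    (mq : ∀ v : HeightOneSpectrum (𝓞 ↥(maximalRealSubfield L)),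
      OrbitalMeasureFamily ((UnitaryGroup.cmDatum L 3 (Matrix.of fun i j : Fin 3 => if i.val + j.val + 1 = 3 then (1 : L) else 0)).Local v))
    (mqi : OrbitalMeasureFamily (UnitaryGroup.arch (↥(maximalRealSubfield L)) L (IsCMField.complexConj L) 3
      (Matrix.of fun i j : Fin 3 => if i.val + j.val + 1 = 3 then (1 : L) else 0)))
    (hadm : ∀ v, (mq v).IsAdmissibleOn fun x : (UnitaryGroup.cmDatum L 3 (Matrix.of fun i j : Fin 3 => if i.val + j.val + 1 = 3 then (1 : L) else 0)).Local v =>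
      Corresponds (UnitaryGroup.conjLocal L (IsCMField.complexConj L) v)
        ((UnitaryGroup.adelicForm L 3 H).map (UnitaryGroup.adeleToLocal L v))
        ((UnitaryGroup.adelicForm L 3 (Matrix.of fun i j : Fin 3 => if i.val + j.val + 1 = 3 then (1 : L) else 0)).map (UnitaryGroup.adeleToLocal L v))
        ((UnitaryGroup.cmDatum L 3 H).toLocal v ((UnitaryGroup.cmDatum L 3 H).toAdelic γ₀)) x)
    (hadmA : mqi.IsAdmissibleOn fun a : UnitaryGroup.arch (↥(maximalRealSubfield L)) L (IsCMField.complexConj L) 3 (Matrix.of fun i j : Fin 3 => if i.val + j.val + 1 = 3 then (1 : L) else 0) =>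
      Corresponds (UnitaryGroup.conjMixed (↥(maximalRealSubfield L)) L (IsCMField.complexConj L)) (UnitaryGroup.archFormOf L 3 H)
        (UnitaryGroup.archFormOf L 3 (Matrix.of fun i j : Fin 3 => if i.val + j.val + 1 = 3 then (1 : L) else 0)) (cmRationalToArch L 3 H γ₀) a)
    (hnormγ : ∃ S₀ : Finset (HeightOneSpectrum (𝓞 ↥(maximalRealSubfield L))),
      UnitaryGroup.IsNormalisedOff L 3 (Matrix.of fun i j : Fin 3 => if i.val + j.val + 1 = 3 then (1 : L) else 0) mq
        ((UnitaryGroup.cmDatum L 3 (Matrix.of fun i j : Fin 3 => if i.val + j.val + 1 = 3 then (1 : L) else 0)).toAdelic γ) S₀)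
    (hnorm : ∀ p : MatchingAdeleG L H γ₀, ∃ S₀ : Finset (HeightOneSpectrum (𝓞 ↥(maximalRealSubfield L))),
      UnitaryGroup.IsNormalisedOff L 3 (Matrix.of fun i j : Fin 3 => if i.val + j.val + 1 = 3 then (1 : L) else 0) mq p.adele S₀)
    (T : UnitaryGroup.PureTensor L 3 (Matrix.of fun i j : Fin 3 => if i.val + j.val + 1 = 3 then (1 : L) else 0)) (hT : T.IsTest)
    (w : ConjClasses (UnitaryGroup.cmDatum L 3 (Matrix.of fun i j : Fin 3 => if i.val + j.val + 1 = 3 then (1 : L) else 0)).Adelic → ℂ)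
    (wloc : ∀ v : HeightOneSpectrum (𝓞 ↥(maximalRealSubfield L)), ConjClasses ((UnitaryGroup.cmDatum L 3 (Matrix.of fun i j : Fin 3 => if i.val + j.val + 1 = 3 then (1 : L) else 0)).Local v) → ℂ)
    (warch : ConjClasses (UnitaryGroup.arch (↥(maximalRealSubfield L)) L (IsCMField.complexConj L) 3 (Matrix.of fun i j : Fin 3 => if i.val + j.val + 1 = 3 then (1 : L) else 0)) → ℂ)
    (hwE : ∀ c ∈ MatchingAdeleG.classes L H γ₀, ∃ Sw : Finset (HeightOneSpectrum (𝓞 ↥(maximalRealSubfield L))),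
      (∀ v ∉ Sw, wloc v (ConjClasses.mk ((UnitaryGroup.cmDatum L 3 (Matrix.of fun i j : Fin 3 => if i.val + j.val + 1 = 3 then (1 : L) else 0)).toLocal v (Quotient.out c))) = 1) ∧
      w c = warch (ConjClasses.mk (UnitaryGroup.archPart (↥(maximalRealSubfield L)) L (IsCMField.complexConj L) 3 (Matrix.of fun i j : Fin 3 => if i.val + j.val + 1 = 3 then (1 : L) else 0) (Quotient.out c))) *
        ∏ v ∈ Sw, wloc v (ConjClasses.mk ((UnitaryGroup.cmDatum L 3 (Matrix.of fun i j : Fin 3 => if i.val + j.val + 1 = 3 then (1 : L) else 0)).toLocal v (Quotient.out c))))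
    (hw1 : ∀ᶠ v in cofinite, wloc v (ConjClasses.mk ((UnitaryGroup.cmDatum L 3 (Matrix.of fun i j : Fin 3 => if i.val + j.val + 1 = 3 then (1 : L) else 0)).toLocal v ((UnitaryGroup.cmDatum L 3 (Matrix.of fun i j : Fin 3 => if i.val + j.val + 1 = 3 then (1 : L) else 0)).toAdelic γ))) = 1) :
    ∃ S₁ : Finset (HeightOneSpectrum (𝓞 ↥(maximalRealSubfield L))), ∀ S : Finset (HeightOneSpectrum (𝓞 ↥(maximalRealSubfield L))), S₁ ⊆ S →
      IsEulerOnClasses (MatchingAdeleG.classes L H γ₀)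
        (UnitaryGroup.OrbitalMeasureFamily.ofLocalAdelic L 3 (Matrix.of fun i j : Fin 3 => if i.val + j.val + 1 = 3 then (1 : L) else 0) mq mqi) (fun x => w (ConjClasses.mk x) * T.eval x) S
        (fun v => localStableOrbitalIntegral L 3 (Matrix.of fun i j : Fin 3 => if i.val + j.val + 1 = 3 then (1 : L) else 0) v (mq v) (fun y => wloc v (ConjClasses.mk y) * T.loc v y)
          ((UnitaryGroup.cmDatum L 3 (Matrix.of fun i j : Fin 3 => if i.val + j.val + 1 = 3 then (1 : L) else 0)).toLocal v
            ((UnitaryGroup.cmDatum L 3 (Matrix.of fun i j : Fin 3 => if i.val + j.val + 1 = 3 then (1 : L) else 0)).toAdelic γ)))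
        (archStableOrbitalIntegral L 3 (Matrix.of fun i j : Fin 3 => if i.val + j.val + 1 = 3 then (1 : L) else 0) mqi (fun a => warch (ConjClasses.mk a) * T.arch a)
          (cmRationalToArch L 3 (Matrix.of fun i j : Fin 3 => if i.val + j.val + 1 = 3 then (1 : L) else 0) γ)) := by
  -- the relation at the correspondent `γ`, semisimplicity of `γ₀`
  have hγab' := mul_sub_smul_mul_sub_smul_eq_zero_of_isConj hγ hγab
  have hss : IsSemisimpleElt (cmConjRingHom L) H γ₀ := isSemisimple_toLin'_of_mul_sub_eq_zero hab hγab
  exact MatchingAdeleG.exists_forall_isEulerOnClasses_ofLocalAdelic_classWeight_of_eventuallyKConj hγ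
    (MatchingAdeleG.eventuallyKConj_of_isSemisimpleElt hss hγ) mq mqi hadm hadmA
    (fun v => UnitaryGroup.isClosed_conjClass_localGL_of_mul_sub_eq_zero 3 v _ (isUnit_algebraMap_localRing_sub v hab)
      (mul_sub_smul_toLocal_toAdelic_eq_zero v γ hγab'))
    (UnitaryGroup.isClosed_conjClass_mixedSpaceGL_of_mul_sub_eq_zero L 3 _ (isUnit_mixedEmbedding_sub hab)
      (mul_sub_smul_cmRationalToArch_eq_zero γ hγab'))
    hnormγ hnorm T hT w wloc warch hwE hw1

end EulerG



end Literature.NumberTheory.Rogawski1990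

end
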